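import Mathlib
import HarnessLib
import Summits.HubbardSuperconductivity.HubbardSuperconductivity.Theorems.KLProgrammeKLRegimeEnginePairTransferDLineTwoShellCrossed

/-!
# Route `KLProgramme` — ENGINE child gen 8 (stmt-HubbardSuperconductivity-20437 `KLRegimeEngineV17F2`), skeleton v2 class #5 rev 3: the deep-pair `D`-rows IN THE
# ROOM's CURRENCY — `(Λₙ−Λₙ₊₁)(βL²)⁻³·WDd ≤ C·A·4^{−(j′−n)}·(72G²·min(|x−y|_𝕋/Λₙ₊₁, Λₙ₊₁/|x−y|_𝕋) + 2⁻ⁿ/4)·(10 + 50Gβ/L)` for EVERY transfer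
# (cell gate-hubbard-kl, seat hubbard-kl-k3c2-p2 g16; KLTC-INDEX v10.3 §D rows «k3c2-p2»; reading of `…DLineSupport` + `…DLineTwoShell(Crossed)`)

WHY.  The budget of the class-#5 STEP (`pairTransferRelResIdx_family_succ_of_analytic`, three fifths of `transferBarRelIdx_succ_room`) offers per pair the slots
`(KlamU)²·[min(|k−k′|/Λₙ₊₁, Λₙ₊₁/|k−k′|) + min(|k+k′−Q_m|/Λₙ₊₁, Λₙ₊₁/|k+k′−Q_m|) + 2⁻ⁿ + 3/L]·klIdxMass n j′`, `klIdxMass n j′ = 15367·4^{−(j′−n)}`.  The two-shell files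
bound the deep-pair `D`-rows by `(Λ(t)+Gδ)/r + √(Λ(t)+Gδ)` at `r ≤ |transfer|_𝕋` ABOVE the threshold `G·|transfer|_𝕋 > Λ(t)/6` and by `0` below it.  This file is the
arithmetic that merges the two regimes into ONE transfer-uniform line in the slots' currency:
* §1 `twoShell_factor_le_slots` — `Λₙ₊₁ ≤ Λ ≤ 4Λₙ₊₁`, `Λ/κ ≤ G·r`, `e ≤ Λ`, `4 ≤ G`, `1 ≤ κ` ⇒ `(Λ+e)/r + √(Λ+e) ≤ 2κ²G²·min(r/Λₙ₊₁, Λₙ₊₁/r) + √(2Λ)`;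
  `sqrt_two_mul_klScale_le` (`√(2Λₙ) = 2⁻ⁿ/4`); `bracket_le` (`(βΛ′/π)(10+2Gβ/L) + 12Gβ/L ≤ (βΛ′/π)(10 + 50Gβ/L)` once `π/(4β) ≤ Λ′`);
* §2 **`WDd_row_le_slots`** — deep pair `n+2 ≤ j′ ≤ j`, `j′`'s scale above `π/(4β)`, `t ∈ [0,1]`, `Gδ ≤ Λₙ₊₁`, `Λₙ + Gδ ≤ klE0`: for ALL `x y`,
  `(Λₙ−Λₙ₊₁)·((βL²)³)⁻¹·WDd(t,x,y) ≤ (9216/π³)·A·4^{−(j′−n)}·(10 + 50Gβ/L)·(72G²·min(|x−y|_𝕋/Λₙ₊₁, Λₙ₊₁/|x−y|_𝕋) + 2⁻ⁿ/4)`;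
  **`WDx_row_le_slots`** — the crossed twin at transfer `x + y − Q_m`: half the prefactor, `338G²` for `72G²` (needs `16π/β ≤ Λₙ₊₁` for the vanishing branch).
* §3 (append) the scale hypotheses in regime form: `pi_div_four_mul_le_klScale_of_le_nScales_succ` (`j′ ≤ n_β+1`), `sixteen_pi_div_le_klScale_succ_of_le_nScales`
  (`n+3 ≤ n_β`), `lattice_fattening_le_of_regime` (`1 ≤ n ≤ n_β`, `8Gβ ≤ L`).
Pure real arithmetic over the companions; `A`, `G = 4 + (8/3)Gfr₁U²` symbolic; nothing about kernel sizes; nothing asserts (X).3, (c), K3 or superconductivity.  0 kit · 0 lit.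
-/

noncomputable section

namespace Summit.HubbardSuperconductivity.HubbardSuperconductivity.Theorems.KLRegimeSplit

set_option linter.dupNamespace false -- summit = problem name (single-conjunct summit), D-0017

open Real Finset Set Literature.MathematicalPhysics.QuantumLattice Literature.Probability.LatticeModels
open Literature.MathematicalPhysics.QuantumLattice.FermiRG
open Summit.HubbardSuperconductivity.HubbardSuperconductivity.Theorems.KLProgrammeLegKernels
open Summit.HubbardSuperconductivity.HubbardSuperconductivity.Theorems.TwoPointAssembly
open Summit.HubbardSuperconductivity.HubbardSuperconductivity.Theorems.DispersionFlow
open Summit.HubbardSuperconductivity.HubbardSuperconductivity.Theorems.KLRegimeWick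
open Summit.HubbardSuperconductivity.HubbardSuperconductivity.Theorems.EngineV8

/-! ## §1 Arithmetic: the two-shell factor in the slots' currency -/

/-- **The two-shell factor in the slots' currency**: `Λ₁ ≤ Λ ≤ 4Λ₁`, `0 < Λ₁`, `Λ/κ ≤ G·r` (`1 ≤ κ`), `4 ≤ G`, `e ≤ Λ` ⇒
`(Λ + e)/r + √(Λ + e) ≤ 2κ²G²·min(r/Λ₁, Λ₁/r) + √(2Λ)`. -/
theorem twoShell_factor_le_slots {Λ Λ₁ G r e κ : ℝ} (hΛ₁ : 0 < Λ₁) (h1 : Λ₁ ≤ Λ) (h4 : Λ ≤ 4 * Λ₁) (hG : 4 ≤ G) (hκ : 1 ≤ κ)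
    (hr : Λ / κ ≤ G * r) (he : e ≤ Λ) :
    (Λ + e) / r + Real.sqrt (Λ + e) ≤ 2 * κ ^ 2 * G ^ 2 * min (r / Λ₁) (Λ₁ / r) + Real.sqrt (2 * Λ) := by
  have hΛ : 0 < Λ := hΛ₁.trans_le h1
  have hG0 : 0 < G := by linarith
  have hκ0 : 0 < κ := by linarith
  have hΛκ : 0 < Λ / κ := by positivity
  have hr0 : 0 < r := by
    by_contra h; push Not at h
    have : G * r ≤ 0 := mul_nonpos_of_nonneg_of_nonpos hG0.le h
    linarith
  have hsq : Real.sqrt (Λ + e) ≤ Real.sqrt (2 * Λ) := Real.sqrt_le_sqrt (by linarith)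
  have hfrac : (Λ + e) / r ≤ 2 * Λ / r := div_le_div_of_nonneg_right (by linarith) hr0.le
  suffices hmain : 2 * Λ / r ≤ 2 * κ ^ 2 * G ^ 2 * min (r / Λ₁) (Λ₁ / r) by linarith
  have hG2 : 16 ≤ G ^ 2 := by nlinarith
  have hκ2 : 1 ≤ κ ^ 2 := by nlinarith
  have hκG : 16 ≤ κ ^ 2 * G ^ 2 := by nlinarith
  rcases le_or_gt Λ₁ r with hcase | hcase
  · -- far transfer: `min = Λ₁/r`, `2Λ/r ≤ 8Λ₁/r`
    rw [min_eq_right (by rw [div_le_div_iff₀ hr0 hΛ₁]; nlinarith)]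
    rw [show 2 * κ ^ 2 * G ^ 2 * (Λ₁ / r) = (2 * (κ ^ 2 * G ^ 2) * Λ₁) / r by ring]
    have h16 : 16 * Λ₁ ≤ κ ^ 2 * G ^ 2 * Λ₁ := mul_le_mul_of_nonneg_right hκG hΛ₁.le
    exact div_le_div_of_nonneg_right (by nlinarith) hr0.le
  · -- near transfer above threshold: `min = r/Λ₁ ≥ 1/(κG)`, `2Λ/r ≤ 2κG`
    rw [min_eq_left (by rw [div_le_div_iff₀ hΛ₁ hr0]; nlinarith)]
    have hA : 2 * Λ / r ≤ 2 * κ * G := by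
      rw [div_le_iff₀ hr0]
      have : Λ ≤ κ * (G * r) := by rw [div_le_iff₀ hκ0] at hr; linarith
      nlinarith
    have hB : 1 / (κ * G) ≤ r / Λ₁ := by
      rw [div_le_div_iff₀ (by positivity) hΛ₁]
      have : Λ ≤ κ * (G * r) := by rw [div_le_iff₀ hκ0] at hr; linarith
      nlinarith
    calc 2 * Λ / r ≤ 2 * κ * G := hA
      _ = 2 * κ ^ 2 * G ^ 2 * (1 / (κ * G)) := by field_simp
      _ ≤ 2 * κ ^ 2 * G ^ 2 * (r / Λ₁) := mul_le_mul_of_nonneg_left hB (by positivity)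

/-- `√(2Λₙ) = 2⁻ⁿ/4` (`Λₙ = klE0·4⁻ⁿ`, `klE0 = 1/32`). -/
theorem sqrt_two_mul_klScale_eq (n : ℕ) : Real.sqrt (2 * klScale klE0 n) = ((2 : ℝ) ^ n)⁻¹ / 4 := by
  have h : 2 * klScale klE0 n = (((2 : ℝ) ^ n)⁻¹ / 4) ^ 2 := by
    unfold klScale klE0
    rw [div_pow, inv_pow, show (4 : ℝ) ^ n = (2 ^ n) ^ 2 by rw [show (4 : ℝ) = 2 ^ 2 by norm_num, ← pow_mul, mul_comm, pow_mul]]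
    ring
  rw [h, Real.sqrt_sq (by positivity)]

/-- **The bracket of the weighted mass**: `π/(4β) ≤ Λ′`, `0 < β`, `0 < L`, `0 ≤ G` ⇒ `(βΛ′/π)(10 + 2Gβ/L) + 12Gβ/L ≤ (βΛ′/π)(10 + 50Gβ/L)`. -/
theorem bracket_le {β L G Λ' : ℝ} (hβ : 0 < β) (hL : 0 < L) (hG : 0 ≤ G) (hΛ' : π / (4 * β) ≤ Λ') :
    β * Λ' / π * (10 + 2 * G * β / L) + 12 * G * β / L ≤ β * Λ' / π * (10 + 50 * G * β / L) := by
  have hπ := Real.pi_pos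
  have h1 : 1 / 4 ≤ β * Λ' / π := by
    rw [div_le_div_iff₀ (by norm_num) hπ]
    rw [div_le_iff₀ (by positivity)] at hΛ'
    nlinarith
  have h2 : 0 ≤ 48 * G * β / L := by positivity
  have key := mul_le_mul_of_nonneg_right h1 h2
  calc β * Λ' / π * (10 + 2 * G * β / L) + 12 * G * β / L
      = β * Λ' / π * 10 + β * Λ' / π * (2 * G * β / L) + 1 / 4 * (48 * G * β / L) := by ring
    _ ≤ β * Λ' / π * 10 + β * Λ' / π * (2 * G * β / L) + β * Λ' / π * (48 * G * β / L) := by linarith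
    _ = β * Λ' / π * (10 + 50 * G * β / L) := by ring

/-! ## §2 The deep-pair `D`-rows in the slots' currency, uniformly in the transfer -/

/-- `Λₙ/(βΛ²)·(βΛ_{j′}/π) ≤ 16(Λ_{j′}/Λₙ)/π` once `Λₙ/4 ≤ Λ` (all positive). -/
theorem ratio_le_sixteen {Λn Λj Λ β : ℝ} (hΛn : 0 < Λn) (hΛj : 0 < Λj) (hβ : 0 < β) (hΛ0 : 0 < Λ) (hΛ : Λn / 4 ≤ Λ) :
    Λn / (β * Λ ^ 2) * (β * Λj / π) ≤ 16 * (Λj / Λn) / π := by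
  have hπ := Real.pi_pos
  have e1 : Λn / (β * Λ ^ 2) * (β * Λj / π) = (Λn / Λ ^ 2) * (Λj / π) := by field_simp
  have e2 : 16 * (Λj / Λn) / π = (16 / Λn) * (Λj / π) := by field_simp
  rw [e1, e2]
  refine mul_le_mul_of_nonneg_right ?_ (by positivity)
  rw [div_le_div_iff₀ (by positivity) hΛn]
  nlinarith

/-- The merged prefactor algebra: `(Λₙ−Λₙ₊₁)·((βL²)³)⁻¹·(c·(βL²)²/Λ²·(9AL²/(2π²))·X·B) = c·(27/(8π²))·A·(Λₙ/(βΛ²))·X·B`. -/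
theorem prefactor_eq {β L Λ Λn A X B c : ℝ} (hβ : 0 < β) (hL : 0 < L) (hΛ : 0 < Λ) :
    (Λn - Λn / 4) * ((β * L ^ 2) ^ 3)⁻¹ * (c * (β * L ^ 2) ^ 2 / Λ ^ 2 * (9 * A * L ^ 2 / (2 * π ^ 2) * X * B)) =
      c * (27 / (8 * π ^ 2)) * A * (Λn / (β * Λ ^ 2)) * X * B := by
  have hπ := Real.pi_pos.ne'
  field_simp
  ring

/-- **THE DIRECT `D`-ROW IN THE SLOTS' CURRENCY, EVERY TRANSFER.**  Deep pair `n + 2 ≤ j′ ≤ j` with `π/(4β) ≤ Λ_{j′}`, `t ∈ [0,1]`, frame data as in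
`WDd_sum_le_twoShell`, `4 ≤ G := 4 + (8/3)Gfr₁U²` (automatic), `Gδ ≤ Λₙ₊₁`, `Λₙ + Gδ ≤ klE0`: for ALL sites `x, y`,
`(Λₙ−Λₙ₊₁)·((βL²)³)⁻¹·WDd(t,x,y) ≤ (9216/π³)·A·4^{−(j′−n)}… ` precisely:
`≤ (512/3)(27/(8π²))·A·(16·Λ_{j′}/Λₙ)/π·(10 + 50Gβ/L)·(72G²·min(|x−y|_𝕋/Λₙ₊₁, Λₙ₊₁/|x−y|_𝕋) + 2⁻ⁿ/4)`. -/
theorem WDd_row_le_slots {L M : ℕ} [NeZero L] [NeZero M] (β μ : ℝ) (K : TrigPolyC4v) {A : ℝ} {u : RenConsts → ℝ} (h : TwoShellFrameAreaAt A u)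
    (hA : 0 ≤ A) {R : RenConsts} (hR : R.WF2) {U : ℝ} (hU : 0 < U) (hUu : U ≤ u R) (hμ : μ ∈ klWindowC) {N : ℕ} (hK : FrameOK R U N μ K)
    (hβ : 0 < β) (n : ℕ) {j j' : ℕ} (hj' : n + 2 ≤ j') (hjj : j' ≤ j) (hj'β : π / (4 * β) ≤ klScale klE0 j') {t : ℝ} (ht : t ∈ Icc (0 : ℝ) 1)
    (hGδ : (4 + 8 / 3 * R.Gfr 1 * U ^ 2) * (2 * π / L) ≤ klScale klE0 (n + 1))
    (hE0 : klScale klE0 n + (4 + 8 / 3 * R.Gfr 1 * U ^ 2) * (2 * π / L) ≤ klE0) (x y : TorusSite 2 L) :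
    (klScale klE0 n - klScale klE0 (n + 1)) * ((β * (L : ℝ) ^ 2) ^ 3)⁻¹ *
      ∑ p : FreqMomentum L M, ∑ _σ : Fin 2, ∑ p' : FreqMomentum L M,
        (if matsubaraInt M p'.1 + matsubaraInt M (omega0 M) = matsubaraInt M p.1 + matsubaraInt M (omega0 M) ∧ p'.2 = p.2 + x - y then
          ‖((((softSymbolCompl L M β μ K (n + 1) j p - softSymbolCompl L M β μ K (n + 1) j' p : ℝ)) : ℂ) * (((β * (L : ℝ) ^ 2 : ℝ) : ℂ) * propCT L M β μ K p)) *
              ((((deriv (fun Λ' : ℝ => hubbardCutoffWeightCT L M β μ K Λ' p') (klScale klE0 n + t * (klScale klE0 (n + 1) - klScale klE0 n)) : ℝ)) : ℂ) *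
                (((β * (L : ℝ) ^ 2 : ℝ) : ℂ) * propCT L M β μ K p')) +
            ((((deriv (fun Λ' : ℝ => hubbardCutoffWeightCT L M β μ K Λ' p) (klScale klE0 n + t * (klScale klE0 (n + 1) - klScale klE0 n)) : ℝ)) : ℂ) *
                (((β * (L : ℝ) ^ 2 : ℝ) : ℂ) * propCT L M β μ K p)) *
              ((((softSymbolCompl L M β μ K (n + 1) j p' - softSymbolCompl L M β μ K (n + 1) j' p' : ℝ)) : ℂ) * (((β * (L : ℝ) ^ 2 : ℝ) : ℂ) * propCT L M β μ K p'))‖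
        else 0) ≤
      512 / 3 * (27 / (8 * π ^ 2)) * A * (16 * (klScale klE0 j' / klScale klE0 n)) / π * (10 + 50 * (4 + 8 / 3 * R.Gfr 1 * U ^ 2) * β / L) *
        (72 * (4 + 8 / 3 * R.Gfr 1 * U ^ 2) ^ 2 * min (klTorusNorm L (x - y) / klScale klE0 (n + 1)) (klScale klE0 (n + 1) / klTorusNorm L (x - y)) +
          ((2 : ℝ) ^ n)⁻¹ / 4) := by
  have hπ := Real.pi_pos
  have hL : (0 : ℝ) < L := by exact_mod_cast Nat.pos_of_ne_zero (NeZero.ne L)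
  have hGfr : ∀ j, 0 ≤ R.Gfr j := hR.wf.2.2
  set G : ℝ := 4 + 8 / 3 * R.Gfr 1 * U ^ 2 with hG
  have hG4 : 4 ≤ G := by rw [hG]; nlinarith [hGfr 1, sq_nonneg U]
  have hG0 : 0 ≤ G := by linarith
  set Λ : ℝ := klScale klE0 n + t * (klScale klE0 (n + 1) - klScale klE0 n) with hΛdef
  have hΛ : 0 < Λ := scaleAt_pos n ht
  obtain ⟨hΛlo, hΛhi⟩ := scaleAt_mem n ht
  rw [← hΛdef] at hΛlo hΛhi
  have hΛn := klth_klScale_pos n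
  have hΛ1 := klth_klScale_pos (n + 1)
  have hΛj := klth_klScale_pos j'
  have hsucc : klScale klE0 (n + 1) = klScale klE0 n / 4 := klth_klScale_succ n
  set r : ℝ := klTorusNorm L (x - y) with hr
  have hr0 : 0 ≤ r := by rw [hr]; unfold klTorusNorm KLProgrammeLegKernels.torusSupNorm torusAbs; positivity
  set mn : ℝ := min (r / klScale klE0 (n + 1)) (klScale klE0 (n + 1) / r) with hmn
  have hmn0 : 0 ≤ mn := le_min (by positivity) (by positivity)
  -- the right-hand side is nonnegative
  have hrhs : 0 ≤ 512 / 3 * (27 / (8 * π ^ 2)) * A * (16 * (klScale klE0 j' / klScale klE0 n)) / π * (10 + 50 * G * β / L) *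
      (72 * G ^ 2 * mn + ((2 : ℝ) ^ n)⁻¹ / 4) := by positivity
  by_cases hsmall : G * r ≤ Λ / 6
  · -- below threshold the row vanishes
    rw [WDd_sum_eq_zero_of_small_transfer β μ K hGfr hK n hj' hjj ht hsmall, mul_zero]
    exact hrhs
  · push Not at hsmall
    have hrpos : 0 < r := by
      by_contra h0; push Not at h0
      have : G * r ≤ 0 := mul_nonpos_of_nonneg_of_nonpos hG0 h0
      linarith
    have hbound := WDd_sum_le_twoShell (L := L) (M := M) β μ K h hA hR hU hUu hμ hK hβ n hj' hjj ht hE0 hrpos (le_refl r)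
    rw [← hΛdef] at hbound
    -- the slots reading of the two-shell factor and of the bracket
    have hX := twoShell_factor_le_slots (e := G * (2 * π / L)) (κ := 6) hΛ1 hΛlo (by rw [hsucc]; linarith) hG4 (by norm_num) hsmall.le (hGδ.trans hΛlo)
    have hX' : (Λ + G * (2 * π / L)) / r + Real.sqrt (Λ + G * (2 * π / L)) ≤ 72 * G ^ 2 * mn + ((2 : ℝ) ^ n)⁻¹ / 4 := by
      refine hX.trans (add_le_add (le_of_eq (by rw [hmn]; norm_num)) ?_)
      rw [← sqrt_two_mul_klScale_eq n]
      exact Real.sqrt_le_sqrt (by linarith)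
    have hB := bracket_le (Λ' := klScale klE0 j') hβ hL hG0 hj'β
    have hXnn : 0 ≤ (Λ + G * (2 * π / L)) / r + Real.sqrt (Λ + G * (2 * π / L)) := by positivity
    have hBnn : 0 ≤ β * klScale klE0 j' / π * (10 + 2 * G * β / L) + 12 * G * β / L := by positivity
    -- multiply out
    have hpre : 0 ≤ (klScale klE0 n - klScale klE0 (n + 1)) * ((β * (L : ℝ) ^ 2) ^ 3)⁻¹ := by
      rw [hsucc]; have : 0 ≤ klScale klE0 n - klScale klE0 n / 4 := by linarith
      positivity
    refine (mul_le_mul_of_nonneg_left hbound hpre).trans ?_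
    rw [hsucc, prefactor_eq hβ hL hΛ]
    -- compare factor by factor
    have hratio : klScale klE0 n / (β * Λ ^ 2) * (β * klScale klE0 j' / π) ≤ 16 * (klScale klE0 j' / klScale klE0 n) / π :=
      ratio_le_sixteen hΛn hΛj hβ hΛ (by rw [hsucc] at hΛlo; exact hΛlo)
    calc 512 / 3 * (27 / (8 * π ^ 2)) * A * (klScale klE0 n / (β * Λ ^ 2)) *
          ((Λ + G * (2 * π / L)) / r + Real.sqrt (Λ + G * (2 * π / L))) *
          (β * klScale klE0 j' / π * (10 + 2 * G * β / L) + 12 * G * β / L)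
        ≤ 512 / 3 * (27 / (8 * π ^ 2)) * A * (klScale klE0 n / (β * Λ ^ 2)) * (72 * G ^ 2 * mn + ((2 : ℝ) ^ n)⁻¹ / 4) *
          (β * klScale klE0 j' / π * (10 + 50 * G * β / L)) := by gcongr
      _ = 512 / 3 * (27 / (8 * π ^ 2)) * A * (klScale klE0 n / (β * Λ ^ 2) * (β * klScale klE0 j' / π)) * (10 + 50 * G * β / L) *
          (72 * G ^ 2 * mn + ((2 : ℝ) ^ n)⁻¹ / 4) := by ring
      _ ≤ 512 / 3 * (27 / (8 * π ^ 2)) * A * (16 * (klScale klE0 j' / klScale klE0 n) / π) * (10 + 50 * G * β / L) *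
          (72 * G ^ 2 * mn + ((2 : ℝ) ^ n)⁻¹ / 4) := by gcongr
      _ = _ := by ring

/-- **THE CROSSED `D`-ROW IN THE SLOTS' CURRENCY, EVERY TRANSFER** (twin of `WDd_row_le_slots` at transfer `x + y − Q_m`, half the prefactor, threshold constant `338 = 2·13²`;
the vanishing branch needs `16π/β ≤ Λₙ₊₁`). -/
theorem WDx_row_le_slots {L M : ℕ} [NeZero L] [NeZero M] (β μ : ℝ) (K : TrigPolyC4v) {A : ℝ} {u : RenConsts → ℝ} (h : TwoShellFrameAreaAt A u)
    (hA : 0 ≤ A) {R : RenConsts} (hR : R.WF2) {U : ℝ} (hU : 0 < U) (hUu : U ≤ u R) (hμ : μ ∈ klWindowC) {N : ℕ} (hK : FrameOK R U N μ K)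
    (hβ : 0 < β) (n : ℕ) (hβn : 16 * π / β ≤ klScale klE0 (n + 1)) {j j' : ℕ} (hj' : n + 2 ≤ j') (hjj : j' ≤ j)
    (hj'β : π / (4 * β) ≤ klScale klE0 j') {t : ℝ} (ht : t ∈ Icc (0 : ℝ) 1)
    (hGδ : (4 + 8 / 3 * R.Gfr 1 * U ^ 2) * (2 * π / L) ≤ klScale klE0 (n + 1))
    (hE0 : klScale klE0 n + (4 + 8 / 3 * R.Gfr 1 * U ^ 2) * (2 * π / L) ≤ klE0) (Qm x y : TorusSite 2 L) :
    (klScale klE0 n - klScale klE0 (n + 1)) * ((β * (L : ℝ) ^ 2) ^ 3)⁻¹ *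
      ∑ p : FreqMomentum L M, ∑ p' : FreqMomentum L M,
        (if matsubaraInt M p'.1 + matsubaraInt M (omega0 M) + matsubaraInt M (omega0 M) + 1 = matsubaraInt M p.1 ∧ p'.2 = p.2 + Qm - x - y then
          ‖((((softSymbolCompl L M β μ K (n + 1) j p - softSymbolCompl L M β μ K (n + 1) j' p : ℝ)) : ℂ) * (((β * (L : ℝ) ^ 2 : ℝ) : ℂ) * propCT L M β μ K p)) *
              ((((deriv (fun Λ' : ℝ => hubbardCutoffWeightCT L M β μ K Λ' p') (klScale klE0 n + t * (klScale klE0 (n + 1) - klScale klE0 n)) : ℝ)) : ℂ) *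
                (((β * (L : ℝ) ^ 2 : ℝ) : ℂ) * propCT L M β μ K p')) +
            ((((deriv (fun Λ' : ℝ => hubbardCutoffWeightCT L M β μ K Λ' p) (klScale klE0 n + t * (klScale klE0 (n + 1) - klScale klE0 n)) : ℝ)) : ℂ) *
                (((β * (L : ℝ) ^ 2 : ℝ) : ℂ) * propCT L M β μ K p)) *
              ((((softSymbolCompl L M β μ K (n + 1) j p' - softSymbolCompl L M β μ K (n + 1) j' p' : ℝ)) : ℂ) * (((β * (L : ℝ) ^ 2 : ℝ) : ℂ) * propCT L M β μ K p'))‖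
        else 0) ≤
      256 / 3 * (27 / (8 * π ^ 2)) * A * (16 * (klScale klE0 j' / klScale klE0 n)) / π * (10 + 50 * (4 + 8 / 3 * R.Gfr 1 * U ^ 2) * β / L) *
        (338 * (4 + 8 / 3 * R.Gfr 1 * U ^ 2) ^ 2 * min (klTorusNorm L (x + y - Qm) / klScale klE0 (n + 1)) (klScale klE0 (n + 1) / klTorusNorm L (x + y - Qm)) +
          ((2 : ℝ) ^ n)⁻¹ / 4) := by
  have hπ := Real.pi_pos
  have hL : (0 : ℝ) < L := by exact_mod_cast Nat.pos_of_ne_zero (NeZero.ne L)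
  have hGfr : ∀ j, 0 ≤ R.Gfr j := hR.wf.2.2
  set G : ℝ := 4 + 8 / 3 * R.Gfr 1 * U ^ 2 with hG
  have hG4 : 4 ≤ G := by rw [hG]; nlinarith [hGfr 1, sq_nonneg U]
  have hG0 : 0 ≤ G := by linarith
  set Λ : ℝ := klScale klE0 n + t * (klScale klE0 (n + 1) - klScale klE0 n) with hΛdef
  have hΛ : 0 < Λ := scaleAt_pos n ht
  obtain ⟨hΛlo, hΛhi⟩ := scaleAt_mem n ht
  rw [← hΛdef] at hΛlo hΛhi
  have hΛn := klth_klScale_pos n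
  have hΛ1 := klth_klScale_pos (n + 1)
  have hΛj := klth_klScale_pos j'
  have hsucc : klScale klE0 (n + 1) = klScale klE0 n / 4 := klth_klScale_succ n
  set r : ℝ := klTorusNorm L (x + y - Qm) with hr
  have hr0 : 0 ≤ r := by rw [hr]; unfold klTorusNorm KLProgrammeLegKernels.torusSupNorm torusAbs; positivity
  have hrneg : klTorusNorm L (Qm - x - y) = r := by rw [hr, show Qm - x - y = -(x + y - Qm) by abel, klvr_klTorusNorm_neg]
  set mn : ℝ := min (r / klScale klE0 (n + 1)) (klScale klE0 (n + 1) / r) with hmn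
  have hmn0 : 0 ≤ mn := le_min (by positivity) (by positivity)
  have hrhs : 0 ≤ 256 / 3 * (27 / (8 * π ^ 2)) * A * (16 * (klScale klE0 j' / klScale klE0 n)) / π * (10 + 50 * G * β / L) *
      (338 * G ^ 2 * mn + ((2 : ℝ) ^ n)⁻¹ / 4) := by positivity
  by_cases hsmall : G * r ≤ Λ / 13
  · rw [WDx_sum_eq_zero_of_small_transfer β μ K hGfr hK hβ n hβn hj' hjj ht (by rw [hrneg]; exact hsmall), mul_zero]
    exact hrhs
  · push Not at hsmall
    have hrpos : 0 < r := by
      by_contra h0; push Not at h0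
      have : G * r ≤ 0 := mul_nonpos_of_nonneg_of_nonpos hG0 h0
      linarith
    have hbound := WDx_sum_le_twoShell (L := L) (M := M) β μ K h hA hR hU hUu hμ hK hβ n hj' hjj ht hE0 hrpos (le_refl r)
    rw [← hΛdef] at hbound
    have hX := twoShell_factor_le_slots (e := G * (2 * π / L)) (κ := 13) hΛ1 hΛlo (by rw [hsucc]; linarith) hG4 (by norm_num) hsmall.le (hGδ.trans hΛlo)
    have hX' : (Λ + G * (2 * π / L)) / r + Real.sqrt (Λ + G * (2 * π / L)) ≤ 338 * G ^ 2 * mn + ((2 : ℝ) ^ n)⁻¹ / 4 := by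
      refine hX.trans (add_le_add (le_of_eq (by rw [hmn]; norm_num)) ?_)
      rw [← sqrt_two_mul_klScale_eq n]
      exact Real.sqrt_le_sqrt (by linarith)
    have hB := bracket_le (Λ' := klScale klE0 j') hβ hL hG0 hj'β
    have hXnn : 0 ≤ (Λ + G * (2 * π / L)) / r + Real.sqrt (Λ + G * (2 * π / L)) := by positivity
    have hBnn : 0 ≤ β * klScale klE0 j' / π * (10 + 2 * G * β / L) + 12 * G * β / L := by positivity
    have hpre : 0 ≤ (klScale klE0 n - klScale klE0 (n + 1)) * ((β * (L : ℝ) ^ 2) ^ 3)⁻¹ := by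
      rw [hsucc]; have : 0 ≤ klScale klE0 n - klScale klE0 n / 4 := by linarith
      positivity
    refine (mul_le_mul_of_nonneg_left hbound hpre).trans ?_
    rw [hsucc, prefactor_eq hβ hL hΛ]
    have hratio : klScale klE0 n / (β * Λ ^ 2) * (β * klScale klE0 j' / π) ≤ 16 * (klScale klE0 j' / klScale klE0 n) / π :=
      ratio_le_sixteen hΛn hΛj hβ hΛ (by rw [hsucc] at hΛlo; exact hΛlo)
    calc 256 / 3 * (27 / (8 * π ^ 2)) * A * (klScale klE0 n / (β * Λ ^ 2)) *
          ((Λ + G * (2 * π / L)) / r + Real.sqrt (Λ + G * (2 * π / L))) *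
          (β * klScale klE0 j' / π * (10 + 2 * G * β / L) + 12 * G * β / L)
        ≤ 256 / 3 * (27 / (8 * π ^ 2)) * A * (klScale klE0 n / (β * Λ ^ 2)) * (338 * G ^ 2 * mn + ((2 : ℝ) ^ n)⁻¹ / 4) *
          (β * klScale klE0 j' / π * (10 + 50 * G * β / L)) := by gcongr
      _ = 256 / 3 * (27 / (8 * π ^ 2)) * A * (klScale klE0 n / (β * Λ ^ 2) * (β * klScale klE0 j' / π)) * (10 + 50 * G * β / L) *
          (338 * G ^ 2 * mn + ((2 : ℝ) ^ n)⁻¹ / 4) := by ring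
      _ ≤ 256 / 3 * (27 / (8 * π ^ 2)) * A * (16 * (klScale klE0 j' / klScale klE0 n) / π) * (10 + 50 * G * β / L) *
          (338 * G ^ 2 * mn + ((2 : ℝ) ^ n)⁻¹ / 4) := by gcongr
      _ = _ := by ring

/-! ## §3 The regime readings of the scale hypotheses (append, g16) -/

/-- **`π/(4β) ≤ Λ_{j′}` for every `j′ ≤ n_β + 1`** (`klBetaMin ≤ β`): the hypothesis `hj'β` of `WDd_row_le_slots` / `WDx_row_le_slots` in regime form. -/
theorem pi_div_four_mul_le_klScale_of_le_nScales_succ {β : ℝ} (hβ : klBetaMin ≤ β) {j' : ℕ} (hj' : j' ≤ nScales β + 1) :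
    π / (4 * β) ≤ klScale klE0 j' := by
  have hβ0 : 0 < β := pos_of_klBetaMin_le hβ
  have h1 : π / β ≤ klScale klE0 (nScales β) := klth_pi_div_le_klScale_nScales hβ
  have h2 : klScale klE0 (nScales β + 1) ≤ klScale klE0 j' := klld_klScale_anti hj'
  have h3 : klScale klE0 (nScales β + 1) = klScale klE0 (nScales β) / 4 := klth_klScale_succ _
  have e : π / (4 * β) = (π / β) / 4 := by rw [div_div, mul_comm]
  rw [e]
  linarith

/-- **`16π/β ≤ Λₙ₊₁` for every `n + 3 ≤ n_β`** (`klBetaMin ≤ β`): the hypothesis `hβn` of the crossed vanishing branch in regime form (the last three scales are the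
thermal band's). -/
theorem sixteen_pi_div_le_klScale_succ_of_le_nScales {β : ℝ} (hβ : klBetaMin ≤ β) {n : ℕ} (hn : n + 3 ≤ nScales β) :
    16 * π / β ≤ klScale klE0 (n + 1) := by
  have hβ0 : 0 < β := pos_of_klBetaMin_le hβ
  have h1 : π / β ≤ klScale klE0 (nScales β) := klth_pi_div_le_klScale_nScales hβ
  have h2 : klScale klE0 (nScales β) ≤ klScale klE0 (n + 3) := klld_klScale_anti hn
  have h3 : klScale klE0 (n + 3) = klScale klE0 (n + 1) / 16 := by
    rw [show n + 3 = n + 1 + 1 + 1 by ring, klth_klScale_succ, klth_klScale_succ]; ring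
  rw [h3] at h2
  have : π / β * 16 ≤ klScale klE0 (n + 1) := by linarith
  calc 16 * π / β = π / β * 16 := by ring
    _ ≤ klScale klE0 (n + 1) := this

/-- **`Gδ ≤ Λₙ₊₁` and `Λₙ + Gδ ≤ klE0` in regime form**: for `1 ≤ n`, `n ≤ n_β`, `klBetaMin ≤ β` and `8·G·β ≤ L` (`G = 4 + (8/3)Gfr₁U²`, any `0 ≤ G` here):
`G·(2π/L) ≤ Λₙ₊₁` and `Λₙ + G·(2π/L) ≤ klE0`. -/
theorem lattice_fattening_le_of_regime {β G : ℝ} (hβ : klBetaMin ≤ β) (hG : 0 ≤ G) {L : ℕ} (hL : 8 * G * β ≤ L) {n : ℕ} (hn1 : 1 ≤ n) (hn : n ≤ nScales β) :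
    G * (2 * π / L) ≤ klScale klE0 (n + 1) ∧ klScale klE0 n + G * (2 * π / L) ≤ klE0 := by
  have hβ0 : 0 < β := pos_of_klBetaMin_le hβ
  have hπ := Real.pi_pos
  have hq : π / (4 * β) ≤ klScale klE0 (n + 1) := pi_div_four_mul_le_klScale_of_le_nScales_succ hβ (by omega)
  rcases eq_or_lt_of_le hG with hG0 | hGpos
  · rw [← hG0]; simp only [zero_mul, add_zero]
    exact ⟨(klth_klScale_pos _).le, by simpa [klScale] using klld_klScale_anti (Nat.zero_le n)⟩
  have hL0 : (0 : ℝ) < L := lt_of_lt_of_le (by positivity) hL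
  have h1 : G * (2 * π / L) ≤ π / (4 * β) := by
    rw [mul_div_assoc', div_le_div_iff₀ hL0 (by positivity)]
    nlinarith
  refine ⟨h1.trans hq, ?_⟩
  -- `Λₙ ≤ Λ₁ = klE0/4` and `Gδ ≤ Λₙ₊₁ ≤ Λ₁`
  have hn0 : klScale klE0 n ≤ klScale klE0 1 := klld_klScale_anti hn1
  have hn1' : klScale klE0 (n + 1) ≤ klScale klE0 1 := klld_klScale_anti (by omega)
  have hΛ1 : klScale klE0 1 = klE0 / 4 := by rw [klth_klScale_succ 0]; simp [klScale]
  have hE0 : 0 < klE0 := by norm_num [klE0]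
  linarith [h1.trans hq]

end Summit.HubbardSuperconductivity.HubbardSuperconductivity.Theorems.KLRegimeSplit

end
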